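import Summits.BirchSwinnertonDyer.BirchSwinnertonDyer.Theorems.ThetaPartnerAtTwoSignedMainConjectureCMTwoRankZeroOfPubOfFlatOfKZ
import Summits.BirchSwinnertonDyer.BirchSwinnertonDyer.Theorems.ThetaPartnerAtTwoSignedMainConjectureCMTwoRankZeroOfPubMuSplitGlue
import Summits.BirchSwinnertonDyer.BirchSwinnertonDyer.Theorems.ThetaPartnerAtTwoAnalyticMuFlatCMTwoRankZeroOfCuspSpan
import Summits.BirchSwinnertonDyer.BirchSwinnertonDyer.Theorems.ResidualThetaTransportAtTwoCuspSpanEvenAtTwoOdd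
import HarnessLib

/-!
# Route `ThetaPartnerAtTwo` (TP2), crux K2r0P `SignedMainConjectureCMTwoRankZeroOfPub` (stmt-BirchSwinnertonDyer-24945), line `rankzero`
# v15 (8cf97eb87d24241a): the item BY NAME from ONE displayed hypothesis KZ — the μ-input FLAT is now a tree THEOREM

Cell `bsd-wall`, width seat `bsd-wall-tp2-p2-w4` (g8) of the `tp2-p2` lineage. Theorem only; no definition, no named fact, no instance, no
`sorry`. The item is NOT closed by this file: the displayed hypothesis `hKZ` is VERBATIM the registered stub `stub_zetaErlKSideCMTwo`
(= KZ: Kato's zeta-element / explicit-reciprocity / K-side package for the CM newform `f_A` at the inert prime `2`; Kato 2004 Thm. 12.5,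
Prop. 15.9, (15.12.2), Lemma 15.13, §15.15, (15.16.1), Prop. 15.17; Kobayashi 2003 (8.23); Johnson-Leung–Kings 2011 Thm. 5.2 / 5.7 §7.2),
a PUBLISHED INPUT awaiting the route pen's HOLD item (crux dir `…OfPubOfFlat/KZHold.lean`, memo `KZ-DESIGN-g11.md` §4); BSD is NOT proved by
any of this. The audit records `proof.conditional` on the declaration, as for its twin p638949.

THE CERTIFICATE. K2r0P 24945 ⟸ FLAT ∧ K2R0P♭ (glue `Theorems.signedMainConjectureCMTwoRankZeroOfPub_of_flat_of_ofPubOfFlat`, p613233),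
K2R0P♭ 26471 ⟸ KZ (`SignedLowerOffTwo.signedMainConjectureCMTwoRankZeroOfPubOfFlat_of_zetaErlKSide`, lead tp2-p2 g11, p638949 =
composition p632409 ∘ registered stub `stub_poitouTateDeepTwo` p636500), and FLAT = route item μ♭ `AnalyticMuFlatCMTwoRankZero`
(stmt-BirchSwinnertonDyer-26470) is a THEOREM BY NAME: the curve-free node (G′)_N at every odd level — item 27436 `CuspSpanEvenAtTwoOdd`,
CLOSED 2026-08-28T15:07Z by `Theorems.CuspSpanEvenAtTwoOdd_proof` (rtt-p3-w2 g5, p643713) — through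
`AnalyticMuFlatAtTwo.analyticMuFlatCMTwoRankZero_of_cuspSpanEvenAtTwoOdd_rtt` (bsd-tp2-w7 g0, p643522). Hence
`signedMainConjectureCMTwoRankZeroOfPub_of_zetaErlKSide : KZ → K2r0P` — the residual of 24945 is EXACTLY the one displayed hypothesis,
the same as 26471's; the pen's KZ window closes both by one-liners over this file and p638949.

References: Kato, Astérisque 295 (2004), Thm. 12.5, Prop. 15.9, (15.12.2), Lemma 15.13, §15.15, (15.16.1), Prop. 15.17 [Kato2004Asterisque];
Kobayashi, Invent. Math. 152 (2003), Thm. 1.2, Thm. 7.3, (8.23) [Kobayashi2003]; Johnson-Leung–Kings, J. reine angew. Math. 653 (2011),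
Thm. 5.2, Thm. 5.7, §7.2 [JohnsonLeungKings2011]; Pollack, Duke Math. J. 118 (2003), Conj. 6.3, Prop. 6.18 [Pollack2003]; Pollack–Rubin,
Ann. of Math. 159 (2004), Thm. 7.3 [PollackRubin2004].
-/

set_option autoImplicit false
set_option linter.dupNamespace false

noncomputable section

open scoped Classical NumberField MatrixGroups ModularForm

open NumberField IsDedekindDomain CongruenceSubgroup WeierstrassCurve Literature Literature.NumberTheory.EllipticCurves
  Literature.NumberTheory.GaloisRepresentations Literature.NumberTheory.EllipticCurves.ModularForms
  Literature.NumberTheory.EllipticCurves.Rank1Residual Literature.NumberTheory.EllipticCurves.IwasawaDual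
  Literature.NumberTheory.EllipticCurves.Kobayashi2003 Literature.NumberTheory.EllipticCurves.Module
  Literature.NumberTheory.EllipticCurves.Kato2004 Literature.NumberTheory.EllipticCurves.Kato2004.EulerSystemValues
  Literature.NumberTheory.EllipticCurves.GreenbergSelmer Literature.NumberTheory.EllipticCurves.Sprung2012
  ZpExtension Summit.BirchSwinnertonDyer.Rank1Residual.Supersingular
  Summit.BirchSwinnertonDyer.BirchSwinnertonDyer.Theorems.SignedKatoOffTwo

namespace Summit.BirchSwinnertonDyer.BirchSwinnertonDyer.Theorems.SignedLowerOffTwo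

/-- **K2r0P ⟸ KZ.** The route item `SignedMainConjectureCMTwoRankZeroOfPub` (stmt-BirchSwinnertonDyer-24945: PUB¹⁰ ⟹ for every rank-`0` CM
curve `A/ℚ` good supersingular at `2` with `a₂ = 0`, the signed lower divisibility up to a `2`-power / Kobayashi's `+` main conjecture data at
`2` as displayed in the route file) from ONE displayed hypothesis, VERBATIM the registered stub `stub_zetaErlKSideCMTwo` (KZ) of the lines
`rankzero` v15 (24945) and v21 (26471): glue p613233 applied to FLAT by name (`AnalyticMuFlatAtTwo.analyticMuFlatCMTwoRankZero_of_cuspSpanEvenAtTwoOdd_rtt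
`Theorems.CuspSpanEvenAtTwoOdd_proof`, inlined — the 26470 closer proper belongs to the `cuspspan` LEAD bsd-tp2-w6) and to the K2R0P♭
certificate p638949 (`signedMainConjectureCMTwoRankZeroOfPubOfFlat_of_zetaErlKSide hKZ`). CONDITIONAL on `hKZ` (a published input, not a
route item yet); nothing else is assumed. [cite: Kato2004Asterisque, Thm. 12.5, Prop. 15.9, (15.12.2), Lemma 15.13, §15.15, (15.16.1), Prop. 15.17]
[cite: Kobayashi2003, Thm. 7.3 and (8.23)] [cite: JohnsonLeungKings2011, Thm. 5.2, Thm. 5.7 and §7.2] [cite: PollackRubin2004, Thm. 7.3] -/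
theorem signedMainConjectureCMTwoRankZeroOfPub_of_zetaErlKSide
    (hKZ :
    ∀ (v : HeightOneSpectrum (𝓞 ℚ)), ((2 : ℕ) : 𝓞 ℚ) ∈ v.asIdeal →
      ∀ (A : WeierstrassCurve ℚ) [A.IsElliptic] [A.IsGloballyMinimal],
        A.HasCM → A.analyticRank = 0 → GoodSS A 2 → A.frobeniusTrace 2 = 0 →
        2 ∣ A.shaOrder * A.tamagawaProduct →
        ∀ (κ : ZpExtension ℚ 2) (γ : Field.absoluteGaloisGroup ℚ),
          κ.IsCyclotomic → κ.IsTopGenerator γ → IsCyclotomicVariable 2 γ →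
        ∀ [NeZero (A.conductorNorm ℤ)] (f : CuspForm (Gamma0 (A.conductorNorm ℤ)) 2),
          IsNewformOf A f → ∀ (ϖ : ℚ), (ϖ : ℝ) * A.realPeriodRat = plusPeriod f →
        ∀ (Lplus Lminus : IwasawaAlgebra 2), IsPollackPair f 2 Lplus Lminus →
        ∀ [ContinuousSMul ℤ_[2] (A.tateModule 2)] (Y : A.FineSelmerDualData κ γ),
        ∀ 𝔭' : PrimeSpectrum (IwasawaAlgebra 2), 𝔭'.asIdeal.height = 1 →
          PowerSeries.C (2 : ℤ_[2]) ∉ 𝔭'.asIdeal →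
        ∀ (I : Kato2004.IwasawaH1Data A 2 κ γ)
          (pair : ∀ n : ℕ, H1 (tateRep A 2) (κ.layerSubgroup n) →ₗ[ℤ_[2]]
            (localLayerPointsOfEmb κ (closureEmb (K := ℚ) (v.adicCompletion ℚ)) A n →+ ℤ_[2])),
          -- (P1) projection formula
          (∀ (n : ℕ) (x : H1 (tateRep A 2) (κ.layerSubgroup (n + 1))) (Q : localPoints A (v.adicCompletion ℚ))
            (hQ : Q ∈ localLayerPointsOfEmb κ (closureEmb (K := ℚ) (v.adicCompletion ℚ)) A n),
            pair n (layerCores (tateRep A 2) κ n x) ⟨Q, hQ⟩ =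
              pair (n + 1) x ⟨Q, localLayerPointsOfEmb_mono κ (closureEmb (K := ℚ) (v.adicCompletion ℚ)) A (Nat.le_succ n) hQ⟩) →
          -- (P2) Galois invariance, for EVERY `g ∈ Γ_v`
          (∀ (n : ℕ) (g : Field.absoluteGaloisGroup (v.adicCompletion ℚ)) (y : H1 (tateRep A 2) (κ.layerSubgroup n))
            (Q : localPoints A (v.adicCompletion ℚ))
            (hQ : Q ∈ localLayerPointsOfEmb κ (closureEmb (K := ℚ) (v.adicCompletion ℚ)) A n),
            pair n (conjMap (tateRep A 2).toTopRep (κ.layerSubgroup n) (resGalOfEmb (closureEmb (K := ℚ) (v.adicCompletion ℚ)) g) 1 y)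
              ⟨g • Q, smul_mem_localLayerPointsOfEmb κ (closureEmb (K := ℚ) (v.adicCompletion ℚ)) A n g hQ⟩ = pair n y ⟨Q, hQ⟩) →
          -- (P3) residue clause: `pair` IS the `T₂A`-adic local Tate pairing (THE Weil pairings of the tree)
          (∀ (n k : ℕ) (x : H1 (tateRep A 2) (κ.layerSubgroup n))
            (Q : localLayerPointsOfEmb κ (closureEmb (K := ℚ) (v.adicCompletion ℚ)) A n),
            PadicInt.toZModPow k (pair n x Q) =
              LayerPairing.layerPairingPk A κ v (LayerPairing.weilTowerPk A) (LayerPairing.weilTowerPk_pow A)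
                (LayerPairing.weilTowerPk_add_left A) (LayerPairing.weilTowerPk_add_right A) (LayerPairing.weilTowerPk_smul A)
                n k x Q) →
        ∃ (g : Field.absoluteGaloisGroup (v.adicCompletion ℚ))
          (_ : κ.IsTopGenerator (resGalOfEmb (closureEmb (K := ℚ) (v.adicCompletion ℚ)) g))
          (d : ℕ → localPoints A (v.adicCompletion ℚ)) (s : I.H),
          (∀ n, d n ∈ localLayerPointsOfEmb κ (closureEmb (K := ℚ) (v.adicCompletion ℚ)) A n) ∧
          (∀ n, localTraceOfEmb κ (closureEmb (K := ℚ) (v.adicCompletion ℚ)) A (n + 1) (n + 2) (d (n + 2)) = -d n) ∧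
          (∀ n : ℕ, 1 ≤ n → ∀ P ∈ localLayerPointsOfEmb κ (closureEmb (K := ℚ) (v.adicCompletion ℚ)) A n,
            ∃ B ∈ AddSubgroup.closure (Set.range fun σ : Field.absoluteGaloisGroup (v.adicCompletion ℚ) ↦ σ • d n),
              ∃ P' ∈ localLayerPointsOfEmb κ (closureEmb (K := ℚ) (v.adicCompletion ℚ)) A (n - 1),
              ∃ R ∈ localLayerPointsOfEmb κ (closureEmb (K := ℚ) (v.adicCompletion ℚ)) A n, P = B + P' + 2 • R) ∧
          (∀ P ∈ localLayerPointsOfEmb κ (closureEmb (K := ℚ) (v.adicCompletion ℚ)) A 0,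
            ∃ a : ℤ, ∃ R ∈ localLayerPointsOfEmb κ (closureEmb (K := ℚ) (v.adicCompletion ℚ)) A 0, P = a • d 0 + 2 • R) ∧
          -- (ERL_pair) ON THE layer pairings: `ν·P_{n,d_n}(pair n (I.proj n s)) ≡ μ·θ_n (mod ω_n)` in `Λ ⊗ ℚ₂`, `μ, ν ∉ 𝔭'`
          (∃ μ ν : IwasawaAlgebra 2, μ ∉ 𝔭'.asIdeal ∧ ν ∉ 𝔭'.asIdeal ∧
            ∀ n : ℕ, ∃ (m : ℕ) (q : IwasawaAlgebra 2),
              PowerSeries.C ((2 : ℚ_[2]) ^ m) *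
                  (iwasawaToPowerSeries 2 μ * ((mazurTateElement f 2 n).map (algebraMap ℚ ℚ_[2]) : PowerSeries ℚ_[2]) -
                    iwasawaToPowerSeries 2 (ν * pairingSum A (localLayerPointsOfEmb κ (closureEmb (K := ℚ) (v.adicCompletion ℚ)) A n)
                      g n (d n) (pair n (I.proj n s)))) =
                iwasawaToPowerSeries 2 (((cyclotomicOmega 2 n).map (Int.castRingHom ℤ_[2]) : PowerSeries ℤ_[2]) * q)) ∧
          -- (g)^ι REPLACED by its typed K-side input: ONE K-side datum (tower + JLK §7.2 + §15.1 + transport socket)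
          Nonempty (Summit.BirchSwinnertonDyer.BirchSwinnertonDyer.Theorems.KatoDescent.KSideDatum I Y s 𝔭')) :
    Summit.BirchSwinnertonDyer.BirchSwinnertonDyer.Theses.ThetaPartnerAtTwo.SignedMainConjectureCMTwoRankZeroOfPub :=
  Summit.BirchSwinnertonDyer.BirchSwinnertonDyer.Theorems.signedMainConjectureCMTwoRankZeroOfPub_of_flat_of_ofPubOfFlat
    (Summit.BirchSwinnertonDyer.BirchSwinnertonDyer.Theorems.AnalyticMuFlatAtTwo.analyticMuFlatCMTwoRankZero_of_cuspSpanEvenAtTwoOdd_rtt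
      Summit.BirchSwinnertonDyer.BirchSwinnertonDyer.Theorems.CuspSpanEvenAtTwoOdd_proof)
    (signedMainConjectureCMTwoRankZeroOfPubOfFlat_of_zetaErlKSide hKZ)

/-- **K2r0P ⟸ C1, BY NAME.** The same certificate read on the route item C1 `KatoZetaErlKSideCMAtTwoSupply`
(stmt-BirchSwinnertonDyer-28306, HOLD; filed by the route pen at rev 44 as the KZ text with two `let` abbreviations — definitionally the
displayed hypothesis of `signedMainConjectureCMTwoRankZeroOfPub_of_zetaErlKSide`, pen cert `short_iff_long := Iff.rfl`): the twin for
item 24945 of the C2 item `SignedMainConjectureCMTwoRankZeroOfPubOfFlatOfKZ` (28307) of 26471. CONDITIONAL on the HOLD item C1 (a published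
input); BSD is not proved by this. [cite: Kato2004Asterisque, Thm. 12.5, Prop. 15.9, (15.12.2), Lemma 15.13, §15.15, (15.16.1), Prop. 15.17]
[cite: JohnsonLeungKings2011, Thm. 5.2, Thm. 5.7 and §7.2] -/
theorem signedMainConjectureCMTwoRankZeroOfPub_of_katoZetaErlKSideCMAtTwoSupply
    (h : Summit.BirchSwinnertonDyer.BirchSwinnertonDyer.Theses.ThetaPartnerAtTwo.KatoZetaErlKSideCMAtTwoSupply) :
    Summit.BirchSwinnertonDyer.BirchSwinnertonDyer.Theses.ThetaPartnerAtTwo.SignedMainConjectureCMTwoRankZeroOfPub :=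
  signedMainConjectureCMTwoRankZeroOfPub_of_zetaErlKSide h

end Summit.BirchSwinnertonDyer.BirchSwinnertonDyer.Theorems.SignedLowerOffTwo

end
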